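import Summits.RiemannHypothesis.RiemannHypothesis.Theorems.HardyZLehmerSplitSigmaLLaguerreCone
import HarnessLib

/-!
# Crux `SigmaL` (stmt-RiemannHypothesis-24253) — the full LAGUERRE INEQUALITY `Z·Z'' − Z'² < 0` off the
# cones of the off-line zeros (RH-free), i.e. `log |Z|` is strictly concave wherever no off-line zero
# of `ζ` sits (almost) directly overhead

Companion of the cone theorem `laguerreAtCritical_of_offCone`
(`Theorems/HardyZLehmerSplitSigmaLLaguerreCone.lean`, at CRITICAL points of `Z`). The decrement
argument there does not use `Z'(t) = 0`; this module records it as a lemma and draws the consequence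
at every point:

* `logDeriv_decrement_near_of_offCone` — for `t ≥ 3·10¹²` with `Z(t) ≠ 0`, if every zero `β + iγ`
  of `ζ` with `|γ − t| < 1` is on the line or has `2|β − ½| < |γ − t|`, then on some interval around
  `t` the logarithmic derivative `Z'/Z` drops at a rate `c > 0` (`c = 1/243 − 4/(t − ½)` works);
* `laguerre_of_offCone` — hence `Z(t)·Z''(t) − Z'(t)² ≤ −c·Z(t)² < 0`: the `t`-line Laguerre
  inequality (under RH: `Ξ` in the Laguerre–Pólya class, `(Z'/Z)' < 0`) holds RH-FREE at every
  `t ≥ 3·10¹²` that is not under the doubled cone of an off-line zero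
  (cf. `laguerre_of_onLine`, which needed the zeros with ordinate in `(t − 3/2, t + 9)` on the line);
* `exists_offLine_zero_cone_of_laguerre_failure` — contrapositive, unconditional: `Z(t) ≠ 0` and
  `Z(t)·Z''(t) ≥ Z'(t)²` (`log |Z|` not strictly concave at `t`) at `t ≥ 3·10¹²` force an OFF-line zero
  `β + iγ` with `|γ − t| ≤ 2|β − ½| < 1`.

NOTHING HERE PROVES OR ASSUMES RH; the stub `stub_laguerreAtCritical` and the crux `SigmaL` stay OPEN.
References: Ivić 2003 §2 Prop. 1 [Ivic2003]; Edwards 1974 §8.3 [Edwards1974].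
-/

set_option linter.dupNamespace false
set_option autoImplicit false

noncomputable section

open Complex Filter Set
open scoped Real Topology
open Literature.NumberTheory.LFunctions
open Summit.RiemannHypothesis.RiemannHypothesis.Theorems.SigmaLRung

namespace Summit.RiemannHypothesis.RiemannHypothesis.Theorems.SigmaLBirth

/-- **The decrement of `Z'/Z` near a point off the cones (RH-free).** For `t ≥ 3·10¹²` with
`Z(t) ≠ 0`: if every zero `β + iγ` of `ζ` with `|γ − t| < 1` is on the line or has `2|β − ½| < |γ − t|`,
then there are `c > 0` and `η > 0` with `(t₂ − t₁)·c ≤ Z'/Z(t₁) − Z'/Z(t₂)` for all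
`t − η < t₁ < t₂ < t + η` (steps (1)–(5) of `laguerreAtCritical_of_offCone`: one zero within `8`,
outside its doubled cone, finitely many zeros within `1`, `logDeriv_decrement_cone` with `C₀ = 9`,
`c = 1/243 − 4/(t − η)`). Nothing here bears on the truth of RH.
[cite: Ivic2003, §2, proof of Prop. 1 (cone form)] -/
theorem logDeriv_decrement_near_of_offCone {t : ℝ} (ht : 3000000000000 ≤ t)
    (hcone : ∀ s : ℂ, riemannZeta s = 0 → |s.im - t| < 1 →
      s.re = 1 / 2 ∨ 2 * |s.re - 1 / 2| < |s.im - t|)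
    (hZ : hardyZ t ≠ 0) :
    ∃ c : ℝ, 0 < c ∧ ∃ η : ℝ, 0 < η ∧ ∀ t₁ t₂ : ℝ, t₁ ∈ Ioo (t - η) (t + η) →
      t₂ ∈ Ioo (t - η) (t + η) → t₁ < t₂ →
        (t₂ - t₁) * c ≤ deriv hardyZ t₁ / hardyZ t₁ - deriv hardyZ t₂ / hardyZ t₂ := by
  -- (1) the rate zero `ρ₀`, `t < γ₀ ≤ t + 8`, outside its doubled cone at `t`
  obtain ⟨ρ₀, hρ₀, hγ₀t, hγ₀8⟩ :=
    exists_zero_of_count_lt (by norm_num) (zetaZeroCount_lt_add_eight ht)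
  obtain ⟨h0, h1⟩ := re_mem_Ioo_of_riemannZeta_eq_zero_of_im_ne_zero hρ₀
    (by intro h; rw [h] at hγ₀t; linarith)
  have hdc₀ : 2 * |ρ₀.re - 1 / 2| < ρ₀.im - t := by
    by_cases hlt1 : ρ₀.im - t < 1
    · rcases hcone ρ₀ hρ₀ (by rw [abs_lt]; constructor <;> linarith) with h | h
      · rw [h]; norm_num; linarith
      · rwa [abs_of_pos (by linarith : 0 < ρ₀.im - t)] at h
    · push Not at hlt1
      have : |ρ₀.re - 1 / 2| < 1 / 2 := by rw [abs_lt]; constructor <;> linarith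
      linarith
  -- (2) `Z ≠ 0` near `t`
  obtain ⟨ε, hε, hball⟩ :=
    Metric.eventually_nhds_iff.1 ((continuous_hardyZ.continuousAt (x := t)).eventually_ne hZ)
  -- (3) the finitely many zeros with ordinate within `1` of `t`
  set F : Set ℂ := {s | riemannZeta s = 0 ∧ |s.im - t| < 1} with hF
  have hFfin : F.Finite := by
    refine (zetaZeroBox_finite 0 (t + 1)).subset ?_
    rintro s ⟨hs, hst⟩
    rw [abs_lt] at hst
    obtain ⟨hr0, hr1⟩ := re_mem_Ioo_of_riemannZeta_eq_zero_of_im_ne_zero hs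
      (by intro h; rw [h] at hst; linarith [hst.1])
    exact ⟨hs, hr0.le, hr1.le, by linarith, by linarith⟩
  -- (4) eventually near `t`: off the cone of every `s ∈ F`, on the side of `t`; off the doubled
  -- cone of `ρ₀`; inside the `Z ≠ 0` ball (then also within `½` of `t`)
  have hevF : ∀ᶠ u in 𝓝 t, ∀ s ∈ F, s.re = 1 / 2 ∨
      (|s.re - 1 / 2| < |u - s.im| ∧ 0 < (u - s.im) * (t - s.im)) := by
    rw [hFfin.eventually_all]
    rintro s ⟨hs, hst⟩
    rcases hcone s hs hst with h | h
    · exact Filter.Eventually.of_forall fun u ↦ Or.inl h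
    · have habs : 0 ≤ |s.re - 1 / 2| := abs_nonneg _
      have h1' : |s.re - 1 / 2| < |t - s.im| := by rw [abs_sub_comm t s.im]; linarith
      have hne : t - s.im ≠ 0 := by
        intro h0'
        rw [h0', abs_zero] at h1'
        linarith
      have h2' : 0 < (t - s.im) * (t - s.im) := mul_self_pos.2 hne
      have c1 : ContinuousAt (fun u : ℝ ↦ |u - s.im|) t := by fun_prop
      have c2 : ContinuousAt (fun u : ℝ ↦ (u - s.im) * (t - s.im)) t := by fun_prop
      filter_upwards [c1.eventually (lt_mem_nhds h1'), c2.eventually (lt_mem_nhds h2')]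
        with u hu1 hu2
      exact Or.inr ⟨hu1, hu2⟩
  have hev0 : ∀ᶠ u in 𝓝 t, 2 * |ρ₀.re - 1 / 2| < ρ₀.im - u := by
    have c : ContinuousAt (fun u : ℝ ↦ ρ₀.im - u) t := by fun_prop
    exact c.eventually (lt_mem_nhds hdc₀)
  have hevε : ∀ᶠ u in 𝓝 t, dist u t < ε := Metric.ball_mem_nhds t hε
  obtain ⟨η₀, hη₀, hη₀all⟩ := Metric.eventually_nhds_iff.1 (hevF.and (hev0.and hevε))
  set η : ℝ := min η₀ (1 / 2) with hη
  have hηpos : 0 < η := lt_min hη₀ (by norm_num)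
  have hη₀le : η ≤ η₀ := min_le_left _ _
  have hη12 : η ≤ 1 / 2 := min_le_right _ _
  have hmem : ∀ u ∈ Ioo (t - η) (t + η), dist u t < η₀ ∧ |u - t| < 1 / 2 := by
    intro u hu
    have : |u - t| < η := by rw [abs_lt]; constructor <;> linarith [hu.1, hu.2]
    exact ⟨by rw [Real.dist_eq]; linarith, by linarith⟩
  have hfree : ∀ u ∈ Ioo (t - η) (t + η), hardyZ u ≠ 0 := fun u hu ↦
    hball ((hη₀all (hmem u hu).1).2.2)
  -- (5) the linear decrement of `Z'/Z` on `(t − η, t + η)`, rate `c = 1/243 − 4/(t − η) > 0`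
  set c : ℝ := 1 / (3 * (9 : ℝ) ^ 2) - 4 / (t - η) with hc
  have hcpos : 0 < c := by
    rw [hc, sub_pos, div_lt_div_iff₀ (by linarith) (by norm_num)]
    linarith
  have hdec : ∀ t₁ t₂ : ℝ, t₁ ∈ Ioo (t - η) (t + η) → t₂ ∈ Ioo (t - η) (t + η) → t₁ < t₂ →
      (t₂ - t₁) * c ≤ deriv hardyZ t₁ / hardyZ t₁ - deriv hardyZ t₂ / hardyZ t₂ := by
    intro t₁ t₂ ht₁ ht₂ hlt
    obtain ⟨hd₁, h12₁⟩ := hmem t₁ ht₁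
    obtain ⟨hd₂, h12₂⟩ := hmem t₂ ht₂
    obtain ⟨hF₁, -, -⟩ := hη₀all hd₁
    obtain ⟨hF₂, h0₂, -⟩ := hη₀all hd₂
    rw [abs_lt] at h12₁ h12₂
    refine logDeriv_decrement_cone (ρ₀ := ρ₀) (C₀ := 9) (by linarith) hfree ht₁ ht₂ hlt ?_ hρ₀ h0
      h1 (by linarith [abs_nonneg (ρ₀.re - 1 / 2)]) (by linarith) ?_
    · -- the cone condition at `(t₁, t₂)` for every zero in the strip
      intro s hs hr0 hr1
      have hβ : |s.re - 1 / 2| < 1 / 2 := by rw [abs_lt]; constructor <;> linarith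
      have hsq : (s.re - 1 / 2) ^ 2 = |s.re - 1 / 2| * |s.re - 1 / 2| := by
        rw [← sq, sq_abs]
      by_cases hsF : |s.im - t| < 1
      · have hs' : s ∈ F := ⟨hs, hsF⟩
        rcases hF₁ s hs' with h | ⟨ha₁, hb₁⟩
        · exact Or.inl h
        rcases hF₂ s hs' with h | ⟨ha₂, hb₂⟩
        · exact Or.inl h
        right
        have hprod : 0 < (t₁ - s.im) * (t₂ - s.im) := by
          have hm := mul_pos hb₁ hb₂
          have e : (t₁ - s.im) * (t - s.im) * ((t₂ - s.im) * (t - s.im)) =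
              (t₁ - s.im) * (t₂ - s.im) * (t - s.im) ^ 2 := by ring
          rw [e] at hm
          exact pos_of_mul_pos_left hm (sq_nonneg _)
        have habs := abs_nonneg (s.re - 1 / 2)
        have hlt' := mul_lt_mul'' ha₁ ha₂ habs habs
        rw [← abs_mul (t₁ - s.im) (t₂ - s.im), abs_of_pos hprod] at hlt'
        rwa [hsq]
      · push Not at hsF
        right
        have habs := abs_nonneg (s.re - 1 / 2)
        have hq : |s.re - 1 / 2| * |s.re - 1 / 2| < 1 / 2 * (1 / 2) :=
          mul_lt_mul'' hβ hβ habs habs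
        rw [hsq]
        rcases le_abs'.1 hsF with hle | hle
        · -- `s.im ≤ t − 1`
          have a1 : 1 / 2 ≤ t₁ - s.im := by linarith
          have a2 : 1 / 2 ≤ t₂ - s.im := by linarith
          have := mul_le_mul a1 a2 (by norm_num) (by linarith)
          linarith
        · -- `t + 1 ≤ s.im`
          have a1 : 1 / 2 ≤ s.im - t₁ := by linarith
          have a2 : 1 / 2 ≤ s.im - t₂ := by linarith
          have := mul_le_mul a1 a2 (by norm_num) (by linarith)
          have e : (t₁ - s.im) * (t₂ - s.im) = (s.im - t₁) * (s.im - t₂) := by ring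
          linarith
    · -- the doubled cone of `ρ₀` at `t₂`
      have hx : 0 ≤ 2 * |ρ₀.re - 1 / 2| := by positivity
      have hsq := mul_lt_mul'' h0₂ h0₂ hx hx
      have e : 2 * |ρ₀.re - 1 / 2| * (2 * |ρ₀.re - 1 / 2|) = 4 * (ρ₀.re - 1 / 2) ^ 2 := by
        rw [show (ρ₀.re - 1 / 2) ^ 2 = |ρ₀.re - 1 / 2| ^ 2 from (sq_abs _).symm]; ring
      rw [e, ← sq] at hsq
      exact hsq.le
  exact ⟨c, hcpos, η, hηpos, hdec⟩

/-- **LAGUERRE INEQUALITY OFF THE CONES (RH-free, quantitative).** For `t ≥ 3·10¹²` with `Z(t) ≠ 0`: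
if every zero `β + iγ` of `ζ` with `|γ − t| < 1` is on the critical line or has `2|β − ½| < |γ − t|`,
then `Z(t)·Z''(t) − Z'(t)² < 0` (indeed `≤ −c·Z(t)²` with the `c > 0` of
`logDeriv_decrement_near_of_offCone`): `(Z'/Z)'(t) = (Z Z'' − Z'²)/Z²(t)` is the limit of slopes all
`≤ −c`. The `t`-line Laguerre inequality, which under RH expresses that `Ξ` is in the Laguerre–Pólya
class, thus holds unconditionally away from the doubled cones of off-line zeros. Nothing here bears on
the truth of RH. [cite: Ivic2003, §2 Prop. 1 (cone form, full Laguerre inequality)] -/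
theorem laguerre_of_offCone {t : ℝ} (ht : 3000000000000 ≤ t)
    (hcone : ∀ s : ℂ, riemannZeta s = 0 → |s.im - t| < 1 →
      s.re = 1 / 2 ∨ 2 * |s.re - 1 / 2| < |s.im - t|)
    (hZ : hardyZ t ≠ 0) :
    hardyZ t * deriv (deriv hardyZ) t - deriv hardyZ t ^ 2 < 0 := by
  obtain ⟨c, hcpos, η, hηpos, hdec⟩ := logDeriv_decrement_near_of_offCone ht hcone hZ
  -- `(Z'/Z)'(t) = (Z''Z − Z'Z')/Z²`
  have hder : HasDerivAt (fun s ↦ deriv hardyZ s / hardyZ s)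
      ((deriv (deriv hardyZ) t * hardyZ t - deriv hardyZ t * deriv hardyZ t) / hardyZ t ^ 2) t :=
    (hasDerivAt_deriv_hardyZ t).div (differentiable_hardyZ t).hasDerivAt hZ
  -- the slopes of `Z'/Z` at `t` are all `≤ −c`
  have hle : (deriv (deriv hardyZ) t * hardyZ t - deriv hardyZ t * deriv hardyZ t) / hardyZ t ^ 2 ≤
      -c := by
    have hslope := hasDerivAt_iff_tendsto_slope.mp hder
    have htmem : t ∈ Ioo (t - η) (t + η) := ⟨by linarith, by linarith⟩
    have hev : ∀ᶠ s in 𝓝[≠] t, slope (fun s ↦ deriv hardyZ s / hardyZ s) t s ≤ -c := by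
      have hmem' : Ioo (t - η) (t + η) ∈ 𝓝[≠] t :=
        mem_nhdsWithin_of_mem_nhds (Ioo_mem_nhds (by linarith) (by linarith))
      filter_upwards [hmem', self_mem_nhdsWithin] with s hs hne
      rw [slope_def_field]
      rcases lt_or_gt_of_ne hne with h | h
      · have hd' := hdec s t hs htmem h
        rw [div_le_iff_of_neg (sub_neg.2 h)]
        linarith
      · have hd' := hdec t s htmem hs h
        rw [div_le_iff₀ (sub_pos.2 h)]
        linarith
    exact le_of_tendsto hslope hev
  have hZsq : 0 < hardyZ t ^ 2 := by positivity
  have hmul := mul_le_mul_of_nonneg_right hle hZsq.le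
  have e : (deriv (deriv hardyZ) t * hardyZ t - deriv hardyZ t * deriv hardyZ t) / hardyZ t ^ 2 *
      hardyZ t ^ 2 = hardyZ t * deriv (deriv hardyZ) t - deriv hardyZ t ^ 2 := by
    field_simp
  rw [e] at hmul
  have : -c * hardyZ t ^ 2 < 0 := by nlinarith
  linarith

/-- **Cone locator for failures of the Laguerre inequality (unconditional).** If at some
`t ≥ 3·10¹²` Hardy's `Z` has `Z(t) ≠ 0` and `Z(t)·Z''(t) ≥ Z'(t)²` (`log |Z|` is not strictly concave
at `t`), then `ζ` has a zero `β + iγ` OFF the critical line with `|γ − t| ≤ 2|β − ½|` (`< 1`).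
Contrapositive of `laguerre_of_offCone`; nothing is assumed about RH.
[cite: Ivic2003, §2 Prop. 1 (contrapositive, cone form)] -/
theorem exists_offLine_zero_cone_of_laguerre_failure {t : ℝ} (ht : 3000000000000 ≤ t)
    (hZ : hardyZ t ≠ 0) (hfail : deriv hardyZ t ^ 2 ≤ hardyZ t * deriv (deriv hardyZ) t) :
    ∃ s : ℂ, riemannZeta s = 0 ∧ s.re ≠ 1 / 2 ∧ |s.im - t| ≤ 2 * |s.re - 1 / 2| ∧
      |s.im - t| < 1 := by
  by_contra h
  push Not at h
  have hlt := laguerre_of_offCone ht (fun s hs hst ↦ ?_) hZ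
  · linarith
  by_cases hre : s.re = 1 / 2
  · exact Or.inl hre
  · rcases lt_or_ge (2 * |s.re - 1 / 2|) |s.im - t| with hlt' | hge
    · exact Or.inr hlt'
    · exact absurd (h s hs hre hge) (not_le.2 hst)

/-- **LOCAL IVIĆ THEOREM, CONE FORM (RH-free):** on a zero-free interval `(a, a')` of Hardy's `Z`
with `a ≥ 3·10¹²`, if every `t ∈ (a, a')` is off the doubled cones — every zero `β + iγ` of `ζ` with
`|γ − t| < 1` is on the line or has `2|β − ½| < |γ − t|` — then `Z'/Z` is strictly decreasing on
`(a, a')`. (`SigmaLRung.localIvic` asked instead for all zeros with ordinate in `(a − ½, a' + ½)` to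
be on the line.) From `laguerre_of_offCone`: `(Z'/Z)' = (Z Z'' − Z'²)/Z² < 0` at every point, and
Mathlib's `strictAntiOn_of_deriv_neg`. Nothing here bears on the truth of RH.
[cite: Ivic2003, §2 Prop. 1 (cone form)] -/
theorem strictAntiOn_logDeriv_of_offCones {a a' : ℝ} (ha : 3000000000000 ≤ a)
    (hfree : ∀ t ∈ Ioo a a', hardyZ t ≠ 0)
    (hcone : ∀ t ∈ Ioo a a', ∀ s : ℂ, riemannZeta s = 0 → |s.im - t| < 1 →
      s.re = 1 / 2 ∨ 2 * |s.re - 1 / 2| < |s.im - t|) :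
    StrictAntiOn (fun t ↦ deriv hardyZ t / hardyZ t) (Ioo a a') := by
  have hder : ∀ t ∈ Ioo a a', HasDerivAt (fun s ↦ deriv hardyZ s / hardyZ s)
      ((deriv (deriv hardyZ) t * hardyZ t - deriv hardyZ t * deriv hardyZ t) / hardyZ t ^ 2) t :=
    fun t ht ↦ (hasDerivAt_deriv_hardyZ t).div (differentiable_hardyZ t).hasDerivAt (hfree t ht)
  refine strictAntiOn_of_deriv_neg (convex_Ioo a a')
    (fun t ht ↦ (hder t ht).continuousAt.continuousWithinAt) fun t ht ↦ ?_
  rw [interior_Ioo] at ht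
  rw [(hder t ht).deriv]
  have hZ := hfree t ht
  have hlag := laguerre_of_offCone (by linarith [ht.1]) (hcone t ht) hZ
  have hnum : deriv (deriv hardyZ) t * hardyZ t - deriv hardyZ t * deriv hardyZ t < 0 := by
    have e : deriv (deriv hardyZ) t * hardyZ t - deriv hardyZ t * deriv hardyZ t =
        hardyZ t * deriv (deriv hardyZ) t - deriv hardyZ t ^ 2 := by ring
    rw [e]; exact hlag
  exact div_neg_of_neg_of_pos hnum (by positivity)

/-- **No Lehmer violation on a zero-free stretch off the cones, interval form:** for `A ≥ 3·10¹²`,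
if every `t ∈ (A, B)` is off the doubled cones of the off-line zeros (as in
`strictAntiOn_logDeriv_of_offCones`), then `Z` has no positive local minimum and no negative local
maximum in `(A, B)` (`SigmaLRung.noViolation_of_strictAnti`). Same conclusion as the pointwise
`noViolationAt_of_offCone`, recorded in the shape of `SigmaLRung.noViolationOn_of_onLine`. RH-free;
nothing here bears on the truth of RH. -/
theorem noViolationOn_of_offCones {A B : ℝ} (hA : 3000000000000 ≤ A)
    (hcone : ∀ t ∈ Ioo A B, ∀ s : ℂ, riemannZeta s = 0 → |s.im - t| < 1 →
      s.re = 1 / 2 ∨ 2 * |s.re - 1 / 2| < |s.im - t|) :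
    ∀ t : ℝ, A < t → t < B →
      (IsLocalMin hardyZ t → hardyZ t ≤ 0) ∧ (IsLocalMax hardyZ t → 0 ≤ hardyZ t) :=
  noViolation_of_strictAnti fun a a' ha ha' hfree ↦
    strictAntiOn_logDeriv_of_offCones (by linarith) hfree
      fun t ht ↦ hcone t ⟨lt_of_le_of_lt ha ht.1, lt_of_lt_of_le ht.2 ha'⟩

end Summit.RiemannHypothesis.RiemannHypothesis.Theorems.SigmaLBirth

end
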